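import Literature.NumberTheory.Automorphic.UnramifiedLevelChange
import Literature.NumberTheory.Automorphic.UnramifiedHeckeScalars
import Literature.NumberTheory.Automorphic.BorelStabilizerLattice
import Literature.NumberTheory.Automorphic.ResGLnAdelicCoefficients
import Literature.NumberTheory.Automorphic.CompletedCohomology
import HarnessLib

/-!
# The `p`-power principal congruence tower under an `S`-good level: level data for Hecke operators

Topic `NumberTheory/Automorphic`; namespace `Literature.NumberTheory.Automorphic` (grouping
sub-namespaces `ArithmeticQuotient.IsUnramifiedLevel`, `BigHeckeGLn`, `ResGLnCohomology`).
Theorems only: no definition, no named fact, no instance, no `sorry`.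

For a number field `K`, an open compact level `U₀ ≤ GL_n(𝒪̂_K)` which is hyperspecial at a finite
place `v` (`GL_n(𝒪_v) ↪ U₀` at `v`), a non-zero ideal `𝔫` prime to `v`, and the finite principal
congruence level `K_f(𝔫) = ofFinite⁻¹ K(𝔫)` (`AshSmithTheoryHeckeLevelProofs`,
`UnramifiedLevelChange`), the level `U₀ ∩ K_f(𝔫)` of the tower
`s ↦ U₀ ∩ K_f(𝔭^s)` (`LevelTower.ofSeq U₀ (K(𝔭^·).map sndHom)`, the tower of the named fact
`bianchi_regularAlgebraicCuspidal_isHeckePoint` for `𝔭 = (p)`) satisfies everything the generic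
continuity step (integral eigenclass ⇒ Hecke point of the completed cohomology) asks of a level at
an unramified Hecke element `t = ι_v(a)`:

* `BigHeckeGLn.map_sndHom_principalCongruenceLevel` — the tower's `K(𝔫).map sndHom` IS `K_f(𝔫)`;
  `BigHeckeGLn.ofSeq_comap_principalCongruenceLevel_pow_level` — its `s`-th level is `U₀ ∩ K_f(𝔭^s)`;
* `BigHeckeGLn.isUnramifiedLevel_inf_comap_principalCongruenceLevel` — `U₀ ∩ K_f(𝔫)` is unramified
  at `v ∤ 𝔫` (so `(U₀ ∩ K_f(𝔫)) t (U₀ ∩ K_f(𝔫)) → U₀ t U₀` is a bijection on single cosets,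
  `ArithmeticQuotient.IsUnramifiedLevel.bijOn_quotientMapOfLE`, and all these double cosets are
  finite, `finite_doubleCosetQuot_of_isCompact_isOpen`);
* `ArithmeticQuotient.IsUnramifiedLevel.exists_conj_eq_mul_map_mul` — `u t u⁻¹ ∈ L' t L'` for
  `u ∈ U₀` and any `L' ⊇ ι_v(GL_n(𝒪_v))` (write `u = u₀ ι_v(κ)` with `u₀` trivial at `v`);
* `BigHeckeGLn.normal_inf_comap_principalCongruenceLevel_subgroupOf` — `U₀ ∩ K_f(𝔫) ⊴ U₀`;
* `BigHeckeGLn.sndHom_heckeDiagAt_eq_ofLocal` — the Hecke elements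
  `sndHom (heckeDiagAt n K v ϖ i) = ι_v(diag(ϖ,…,ϖ,1,…,1))` are of the form `ι_v(a)`, and
  `ResGLnCohomology.padicCoeffRep_sndHom_heckeDiagAt` — the `p`-adic coefficient representation is
  trivial on them for `v ∤ p`;
* `BigHeckeGLn.levelData_inf_comap_principalCongruenceLevel` — the four level data assembled.

These are the level-theoretic inputs of the proof of [Scholze2015, Thm. V.4.1 / Cor. V.4.2]
("`𝕋 = 𝕋_{K^p}` acts on all these spaces … compatible for varying `K_p`") for the principal
`p`-power tower; [ShimuraIATAF1971, Ch. 3, Prop. 3.1] for the double-coset bookkeeping.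

## References

* P. Scholze, *On torsion in the cohomology of locally symmetric varieties*, Ann. of Math. 182
  (2015), §V.4 [Scholze2015].
* G. Shimura, *Introduction to the arithmetic theory of automorphic functions* (1971), Ch. 3,
  Prop. 3.1 [ShimuraIATAF1971].
-/

noncomputable section

open scoped NumberField
open IsDedekindDomain

namespace Literature.NumberTheory.Automorphic

/-! ### Conjugating an unramified Hecke element by the level -/

namespace ArithmeticQuotient.IsUnramifiedLevel

variable {𝒢 : Type*} [Group 𝒢] {Gᵥ : Type*} [Group Gᵥ] {Kᵥ : Subgroup Gᵥ} {ιᵥ : Gᵥ →* 𝒢}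
  {πᵥ : 𝒢 →* Gᵥ} {L L' : Subgroup 𝒢}

/-- **`l ιᵥ(y) l⁻¹ = a ιᵥ(y) b` with `a, b ∈ L'`** for `l` in a level `L` unramified at `v` and any
subgroup `L'` containing `ιᵥ(Kᵥ)`: `l = l₀ ιᵥ(κ)`, `κ = πᵥ(l) ∈ Kᵥ`, `l₀` trivial at `v` hence
commuting with `ιᵥ(Gᵥ)`, so `l ιᵥ(y) l⁻¹ = ιᵥ(κ) ιᵥ(y) ιᵥ(κ)⁻¹`.
[cite: ShimuraIATAF1971, Ch. 3, Prop. 3.1] -/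
theorem exists_conj_eq_mul_map_mul (h : IsUnramifiedLevel Kᵥ ιᵥ πᵥ L) (h' : Kᵥ.map ιᵥ ≤ L')
    {l : 𝒢} (hl : l ∈ L) (y : Gᵥ) :
    ∃ a ∈ L', ∃ b ∈ L', l * ιᵥ y * l⁻¹ = a * ιᵥ y * b := by
  have hκ : πᵥ l ∈ Kᵥ := h.apply_mem hl
  refine ⟨ιᵥ (πᵥ l), h' ⟨_, hκ, rfl⟩, ιᵥ (πᵥ l)⁻¹, h' ⟨_, Kᵥ.inv_mem hκ, rfl⟩, ?_⟩
  have hcomm := h.comm_of_apply_eq_one _ (h.apply_mul_inv (l := l)) (πᵥ l * y * (πᵥ l)⁻¹)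
  calc l * ιᵥ y * l⁻¹
      = l * (ιᵥ (πᵥ l))⁻¹ * ιᵥ (πᵥ l * y * (πᵥ l)⁻¹) * (l * (ιᵥ (πᵥ l))⁻¹)⁻¹ := by
        rw [map_mul, map_mul, map_inv]; group
    _ = ιᵥ (πᵥ l * y * (πᵥ l)⁻¹) := by rw [hcomm, mul_inv_cancel_right]
    _ = ιᵥ (πᵥ l) * ιᵥ y * ιᵥ (πᵥ l)⁻¹ := by rw [map_mul, map_mul]

end ArithmeticQuotient.IsUnramifiedLevel

/-! ### The finite principal congruence levels in the tower -/

namespace BigHeckeGLn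

variable {n : ℕ} {K : Type} [Field K] [NumberField K]

/-- **`K(𝔫).map sndHom = K_f(𝔫)`**: the finite parts of the principal congruence subgroup
`K(𝔫) ≤ {1} × GL_n(𝒪̂_K)` form its preimage under `h ↦ (1, h)`. [folklore] -/
theorem map_sndHom_principalCongruenceLevel (𝔫 : Ideal (𝓞 K)) :
    (principalCongruenceLevel n K 𝔫).map (GLn.sndHom n K) =
      (principalCongruenceLevel n K 𝔫).comap (GLn.ofFinite n K) := by
  ext h
  constructor
  · rintro ⟨g, hg, rfl⟩
    rw [Subgroup.mem_comap, GLn.ofFinite_sndHom_of_mem (principalCongruenceLevel_le n K 𝔫 hg)]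
    exact hg
  · intro hh
    exact ⟨GLn.ofFinite n K h, hh, GLn.sndHom_ofFinite h⟩

/-- `K_f(𝔭^s) ≤ K_f(𝔭^r)` for `r ≤ s` (`𝔭 ≠ 0`). [folklore] -/
theorem comap_principalCongruenceLevel_pow_anti {𝔭 : Ideal (𝓞 K)} (h𝔭 : 𝔭 ≠ 0) {r s : ℕ}
    (h : r ≤ s) :
    (principalCongruenceLevel n K (𝔭 ^ s)).comap (GLn.ofFinite n K) ≤
      (principalCongruenceLevel n K (𝔭 ^ r)).comap (GLn.ofFinite n K) :=
  comap_principalCongruenceLevel_mono (pow_ne_zero _ h𝔭) (Ideal.pow_le_pow_right h)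

/-- **The `s`-th level of the tower `LevelTower.ofSeq U₀ (K(𝔭^·).map sndHom)` is `U₀ ∩ K_f(𝔭^s)`.**
[folklore] -/
theorem ofSeq_comap_principalCongruenceLevel_pow_level {𝔭 : Ideal (𝓞 K)} (h𝔭 : 𝔭 ≠ 0)
    (U₀ : Subgroup (FiniteAdelicGL n K)) (s : ℕ) :
    (LevelTower.ofSeq U₀ fun r : ℕ =>
        (principalCongruenceLevel n K (𝔭 ^ r)).map (GLn.sndHom n K)).level s =
      U₀ ⊓ (principalCongruenceLevel n K (𝔭 ^ s)).comap (GLn.ofFinite n K) := by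
  rw [LevelTower.ofSeq_level]
  ext g
  simp only [Subgroup.mem_inf, Subgroup.mem_iInf, map_sndHom_principalCongruenceLevel]
  constructor
  · rintro ⟨hU, hK⟩
    exact ⟨hU, hK s le_rfl⟩
  · rintro ⟨hU, hK⟩
    exact ⟨hU, fun r hr => comap_principalCongruenceLevel_pow_anti h𝔭 hr hK⟩

omit [NumberField K] in
/-- A prime `v` not containing `𝔭` divides no power of `𝔭`. [folklore] -/
theorem not_dvd_pow_of_not_le {𝔭 : Ideal (𝓞 K)} {v : HeightOneSpectrum (𝓞 K)}
    (hv : ¬ 𝔭 ≤ v.asIdeal) (s : ℕ) : ¬ v.asIdeal ∣ 𝔭 ^ s := fun h =>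
  hv (Ideal.IsPrime.le_of_pow_le (I := 𝔭) (Ideal.le_of_dvd h))

/-- **`U₀ ∩ K_f(𝔫)` is unramified at `v ∤ 𝔫`** when `U₀ ≤ GL_n(𝒪̂_K)` contains `ι_v(GL_n(𝒪_v))`.
[cite: ShimuraIATAF1971, Ch. 3, Prop. 3.1] -/
theorem isUnramifiedLevel_inf_comap_principalCongruenceLevel {U₀ : Subgroup (FiniteAdelicGL n K)}
    (hU₀ : U₀ ≤ glFiniteIntegralLevel n K) {v : HeightOneSpectrum (𝓞 K)}
    (hv : ∀ g ∈ valuedCongruenceSubgroup (Fin n) (1 : WithZero (Multiplicative ℤ)),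
      ofLocal n K v g ∈ U₀)
    {𝔫 : Ideal (𝓞 K)} (h𝔫 : 𝔫 ≠ 0) (hv𝔫 : ¬ v.asIdeal ∣ 𝔫) :
    ArithmeticQuotient.IsUnramifiedLevel
      (valuedCongruenceSubgroup (Fin n) (1 : WithZero (Multiplicative ℤ)))
      (ofLocal n K v) (localComponent n K v)
      (U₀ ⊓ (principalCongruenceLevel n K 𝔫).comap (GLn.ofFinite n K)) := by
  refine isUnramifiedLevel_of_le ?_ fun u hu =>
    localComponent_mem_valuedCongruenceSubgroup_one (hU₀ hu.1) v
  rintro _ ⟨g, hg, rfl⟩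
  exact ⟨hv g hg, (isUnramifiedLevel_comap_principalCongruenceLevel h𝔫 hv𝔫).map_le ⟨g, hg, rfl⟩⟩

/-- `U₀` itself is unramified at `v` under the same hypotheses. [folklore] -/
theorem isUnramifiedLevel_of_hyperspecial {U₀ : Subgroup (FiniteAdelicGL n K)}
    (hU₀ : U₀ ≤ glFiniteIntegralLevel n K) {v : HeightOneSpectrum (𝓞 K)}
    (hv : ∀ g ∈ valuedCongruenceSubgroup (Fin n) (1 : WithZero (Multiplicative ℤ)),
      ofLocal n K v g ∈ U₀) :
    ArithmeticQuotient.IsUnramifiedLevel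
      (valuedCongruenceSubgroup (Fin n) (1 : WithZero (Multiplicative ℤ)))
      (ofLocal n K v) (localComponent n K v) U₀ := by
  refine isUnramifiedLevel_of_le ?_ fun u hu =>
    localComponent_mem_valuedCongruenceSubgroup_one (hU₀ hu) v
  rintro _ ⟨g, hg, rfl⟩
  exact hv g hg

/-- **`U₀ ∩ K_f(𝔫)` is normal in `U₀`** for `U₀ ≤ GL_n(𝒪̂_K)` (`K_f(𝔫) ⊴ GL_n(𝒪̂_K)`).
[cite: ShimuraIATAF1971, Ch. 3] -/
theorem normal_inf_comap_principalCongruenceLevel_subgroupOf {U₀ : Subgroup (FiniteAdelicGL n K)}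
    (hU₀ : U₀ ≤ glFiniteIntegralLevel n K) (𝔫 : Ideal (𝓞 K)) :
    ((U₀ ⊓ (principalCongruenceLevel n K 𝔫).comap (GLn.ofFinite n K)).subgroupOf U₀).Normal := by
  refine ⟨fun k hk u => ?_⟩
  rw [Subgroup.mem_subgroupOf] at hk ⊢
  refine ⟨U₀.mul_mem (U₀.mul_mem u.2 hk.1) (U₀.inv_mem u.2), ?_⟩
  exact conj_mem_comap_principalCongruenceLevel (hU₀ u.2) hk.2

/-- `U₀ ∩ K_f(𝔫)` is open (`U₀`, `K_f(𝔫)` open, `𝔫 ≠ 0`). [folklore] -/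
theorem isOpen_inf_comap_principalCongruenceLevel {U₀ : Subgroup (FiniteAdelicGL n K)}
    (hU₀ : IsOpen (U₀ : Set (FiniteAdelicGL n K))) {𝔫 : Ideal (𝓞 K)} (h𝔫 : 𝔫 ≠ 0) :
    IsOpen ((U₀ ⊓ (principalCongruenceLevel n K 𝔫).comap (GLn.ofFinite n K) :
      Subgroup (FiniteAdelicGL n K)) : Set (FiniteAdelicGL n K)) := by
  rw [Subgroup.coe_inf]
  exact hU₀.inter (isOpen_comap_ofFinite_principalCongruenceLevel n K h𝔫)

/-- `U₀ ∩ K_f(𝔫)` is compact (`U₀` compact, `K_f(𝔫)` closed). [folklore] -/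
theorem isCompact_inf_comap_principalCongruenceLevel {U₀ : Subgroup (FiniteAdelicGL n K)}
    (hU₀ : IsCompact (U₀ : Set (FiniteAdelicGL n K))) {𝔫 : Ideal (𝓞 K)} (h𝔫 : 𝔫 ≠ 0) :
    IsCompact ((U₀ ⊓ (principalCongruenceLevel n K 𝔫).comap (GLn.ofFinite n K) :
      Subgroup (FiniteAdelicGL n K)) : Set (FiniteAdelicGL n K)) := by
  rw [Subgroup.coe_inf]
  exact hU₀.inter_right
    (Subgroup.isClosed_of_isOpen _ (isOpen_comap_ofFinite_principalCongruenceLevel n K h𝔫))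

/-- **The Hecke elements of the named fact are local**:
`sndHom (heckeDiagAt n K v ϖ i) = ι_v(diag(ϖ, …, ϖ, 1, …, 1))`. [folklore] -/
theorem sndHom_heckeDiagAt_eq_ofLocal (v : HeightOneSpectrum (𝓞 K)) (ϖ : (v.adicCompletion K)ˣ)
    (i : ℕ) :
    GLn.sndHom n K (heckeDiagAt n K v ϖ i) =
      ofLocal n K v (glDiagonal n (v.adicCompletion K) fun k => if (k : ℕ) < i then ϖ else 1) := by
  rw [heckeDiagAt_eq_ofLocal_glDiagonal]
  rfl

/-- The `w`-component of `sndHom (heckeDiagAt n K v ϖ i)` is trivial for `w ≠ v`. [folklore] -/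
theorem localComponent_sndHom_heckeDiagAt_of_ne {v w : HeightOneSpectrum (𝓞 K)} (h : w ≠ v)
    (ϖ : (v.adicCompletion K)ˣ) (i : ℕ) :
    localComponent n K w (GLn.sndHom n K (heckeDiagAt n K v ϖ i)) = 1 := by
  rw [sndHom_heckeDiagAt_eq_ofLocal, localComponent_ofLocal_of_ne h]

end BigHeckeGLn

/-! ### The `p`-adic coefficient representation is trivial on the Hecke elements away from `p` -/

namespace ResGLnCohomology

variable {n : ℕ} {K : Type} [Field K] [NumberField K] (p : ℕ) [Fact p.Prime]
  (lam : (K →+* PadicAlgCl p) → Fin n → ℤ)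

/-- **`ρ_p(t_{v,i}) = 1` for `v ∤ p`**: the Hecke element `sndHom (heckeDiagAt n K v ϖ i)` has trivial
components at the places over `p`. [cite: Scholze2015, §V.4 (proof of Thm. V.4.1)] -/
theorem padicCoeffRep_sndHom_heckeDiagAt {v : HeightOneSpectrum (𝓞 K)}
    (hv : ((p : ℕ) : 𝓞 K) ∉ v.asIdeal) (ϖ : (v.adicCompletion K)ˣ) (i : ℕ) :
    padicCoeffRep n K p lam (GLn.sndHom n K (heckeDiagAt n K v ϖ i)) = 1 :=
  padicCoeffRep_eq_one_of_localComponent_eq_one n K p lam fun w hw =>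
    BigHeckeGLn.localComponent_sndHom_heckeDiagAt_of_ne (by rintro rfl; exact hv hw) ϖ i

end ResGLnCohomology

/-! ### The level data of the `p`-power tower, assembled -/

namespace BigHeckeGLn

variable {n : ℕ} {K : Type} [Field K] [NumberField K]

/-- **Level data of `U₀ ∩ K_f(𝔫)` at an unramified Hecke element `ι_v(a)`, `v ∤ 𝔫`**, in the shape
consumed by the integral continuity step: with `L' = U₀ ∩ K_f(𝔫) ≤ U₀`, `L'` is normal in `U₀`,
`u ι_v(a) u⁻¹ ∈ L' ι_v(a) L'` for `u ∈ U₀`, `L' ι_v(a) L'/L' → U₀ ι_v(a) U₀/U₀` is bijective, and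
`L' ι_v(a) L'/L'` is finite. [cite: ShimuraIATAF1971, Ch. 3, Prop. 3.1]
[cite: Scholze2015, §V.4 (proof of Thm. V.4.1)] -/
theorem levelData_inf_comap_principalCongruenceLevel {U₀ : Subgroup (FiniteAdelicGL n K)}
    (hU₀o : IsOpen (U₀ : Set (FiniteAdelicGL n K)))
    (hU₀c : IsCompact (U₀ : Set (FiniteAdelicGL n K)))
    (hU₀ : U₀ ≤ glFiniteIntegralLevel n K) {v : HeightOneSpectrum (𝓞 K)}
    (hv : ∀ g ∈ valuedCongruenceSubgroup (Fin n) (1 : WithZero (Multiplicative ℤ)),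
      ofLocal n K v g ∈ U₀)
    {𝔫 : Ideal (𝓞 K)} (h𝔫 : 𝔫 ≠ 0) (hv𝔫 : ¬ v.asIdeal ∣ 𝔫) (a : GL (Fin n) (v.adicCompletion K)) :
    ((U₀ ⊓ (principalCongruenceLevel n K 𝔫).comap (GLn.ofFinite n K)).subgroupOf U₀).Normal ∧
    (∀ u : U₀, ∃ x ∈ U₀ ⊓ (principalCongruenceLevel n K 𝔫).comap (GLn.ofFinite n K),
      ∃ y ∈ U₀ ⊓ (principalCongruenceLevel n K 𝔫).comap (GLn.ofFinite n K),
        (u : FiniteAdelicGL n K) * ofLocal n K v a * (u : FiniteAdelicGL n K)⁻¹ =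
          x * ofLocal n K v a * y) ∧
    Set.BijOn (Subgroup.quotientMapOfLE (inf_le_left : U₀ ⊓
        (principalCongruenceLevel n K 𝔫).comap (GLn.ofFinite n K) ≤ U₀))
      (ArithmeticQuotient.doubleCosetQuot
        (U₀ ⊓ (principalCongruenceLevel n K 𝔫).comap (GLn.ofFinite n K)) (ofLocal n K v a))
      (ArithmeticQuotient.doubleCosetQuot U₀ (ofLocal n K v a)) ∧
    (ArithmeticQuotient.doubleCosetQuot
        (U₀ ⊓ (principalCongruenceLevel n K 𝔫).comap (GLn.ofFinite n K)) (ofLocal n K v a)).Finite := by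
  have hL : ArithmeticQuotient.IsUnramifiedLevel _ (ofLocal n K v) (localComponent n K v) U₀ :=
    isUnramifiedLevel_of_hyperspecial hU₀ hv
  have hL' := isUnramifiedLevel_inf_comap_principalCongruenceLevel hU₀ hv h𝔫 hv𝔫
  refine ⟨normal_inf_comap_principalCongruenceLevel_subgroupOf hU₀ 𝔫, fun u => ?_,
    hL.bijOn_quotientMapOfLE inf_le_left hL' a,
    finite_doubleCosetQuot_of_isCompact_isOpen _ (isCompact_inf_comap_principalCongruenceLevel hU₀c h𝔫)
      (isOpen_inf_comap_principalCongruenceLevel hU₀o h𝔫) _⟩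
  exact hL.exists_conj_eq_mul_map_mul hL'.map_le u.2 a

/-- All double cosets of `U₀` are finite (`U₀` compact open).
[cite: ShimuraIATAF1971, Ch. 3, Prop. 3.1] -/
theorem finite_doubleCosetQuot {U₀ : Subgroup (FiniteAdelicGL n K)}
    (hU₀o : IsOpen (U₀ : Set (FiniteAdelicGL n K)))
    (hU₀c : IsCompact (U₀ : Set (FiniteAdelicGL n K))) (g : FiniteAdelicGL n K) :
    (ArithmeticQuotient.doubleCosetQuot U₀ g).Finite :=
  finite_doubleCosetQuot_of_isCompact_isOpen _ hU₀c hU₀o g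

end BigHeckeGLn

end Literature.NumberTheory.Automorphic
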